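import Mathlib
import Summits.ResolutionOfSingularities.ResolutionOfSingularities.Theorems.WildQuotientsWildQuotientResolutionLinearSmallBlocksFinal
import Summits.ResolutionOfSingularities.ResolutionOfSingularities.Theorems.WildQuotientsWildQuotientResolutionFixedPointsConj
import HarnessLib

/-!
# Rung LSB-lin: every LINEAR `ℤ/p`-action on `𝔸ⁿ` with `(σ − 1)² = 0` has a resolvable quotient

(crux stmt-ResolutionOfSingularities-15640 `WildQuotients.WildQuotientResolution`, line `Sketch`;
rung LSB of `L/w45c/CHAIN.md` v3 in coordinate-free form — the «square-zero normal form» row of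
res-L1-w45c-plan-1 (2026-08-26T23:34:15Z); [OURS · L1 W4.5c] — NOT a statement of any manuscript.)

Let `σ` be a `k`-algebra automorphism of `k[x₀,…,x_{n-1}]` acting LINEARLY on the coordinates,
`σ xᵢ = Σⱼ A i j · xⱼ`, whose matrix satisfies `(A − 1)² = 0` (all Jordan blocks of size `≤ 2`;
in characteristic `p` such a `σ` has order `p` or `1`). Then `Spec k[x]^⟨σ⟩` has a resolution of
singularities, in EVERY characteristic `p` and every `n` (`LinearSquareZero.hasResolution`).
In characteristic `2` the hypothesis `(A − 1)² = 0` is EQUIVALENT to `σ² = 1`, so this covers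
ALL linear involutions of `𝔸ⁿ` in characteristic `2` (`LinearSquareZero.hasResolution_of_involutive`)
— the first complete linear sector of the first open case `CyclicQuotientFourfolds` (17941) at a
prime, in all dimensions at once.

Proof: the Jordan normal form of a square-zero endomorphism `N` (basis `v_j, N v_j, w_l` adapted to
the flag `im N ≤ ker N ≤ V`; `exists_basis_of_sq_eq_zero`) gives an invertible `G` with
`G A G⁻¹ = 1 + (pattern of a coordinate action with blocks ≤ 2)` (`exists_conj_toMvPolynomial`);
the linear substitution `τ : xᵢ ↦ Σⱼ G i j xⱼ` (Mathlib `Matrix.toMvPolynomial` / `bind₁`) is an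
algebra automorphism with `τ⁻¹ σ τ` a coordinate action of rung LSB
(`LinearSmallBlocks.hasResolution`, res-L1-w45c-stub-3/stub-2), and conjugate cyclic actions have
isomorphic quotients (`TameTransfer.hasResolution_fixedPoints_zpowers_conj`).
-/

-- single-problem summit: the doubled namespace component `ResolutionOfSingularities` is forced
set_option linter.dupNamespace false

noncomputable section

open MvPolynomial AlgebraicGeometry CategoryTheory Module Literature.AlgebraicGeometry.Resolution
open scoped Matrix

namespace Summit.ResolutionOfSingularities.ResolutionOfSingularities.Theorems.WildQuotientResolution.LinearSquareZero

section LinearAlgebra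

variable {k V : Type*} [Field k] [AddCommGroup V] [Module k V] [FiniteDimensional k V]

omit [FiniteDimensional k V] in
/-- Transport of a basis adapted to a square-zero endomorphism (`N bᵢ = b_{f i}` on `D`,
`N bᵢ = 0` off `D`, `f(D) ∩ D = ∅`) along a reindexing `ι₀ ≃ ι`. [folklore] -/
theorem exists_basis_reindex {ι₀ ι : Type*} (N : V →ₗ[k] V) (b : Basis ι₀ k V) (D : Finset ι₀)
    (f : ι₀ → ι₀) (h1 : ∀ i ∈ D, f i ∉ D) (h2 : ∀ i ∈ D, N (b i) = b (f i))
    (h3 : ∀ i ∉ D, N (b i) = 0) (ε : ι₀ ≃ ι) :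
    ∃ (b' : Basis ι k V) (D' : Finset ι) (f' : ι → ι),
      (∀ i ∈ D', f' i ∉ D') ∧ (∀ i ∈ D', N (b' i) = b' (f' i)) ∧ ∀ i ∉ D', N (b' i) = 0 := by
  refine ⟨b.reindex ε, D.map ε.toEmbedding, fun i => ε (f (ε.symm i)), ?_, ?_, ?_⟩
  · intro i hi
    rw [Finset.mem_map_equiv] at hi ⊢
    rw [Equiv.symm_apply_apply]
    exact h1 _ hi
  · intro i hi
    rw [Finset.mem_map_equiv] at hi
    rw [Basis.reindex_apply, Basis.reindex_apply, Equiv.symm_apply_apply]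
    exact h2 _ hi
  · intro i hi
    rw [Finset.mem_map_equiv] at hi
    rw [Basis.reindex_apply]
    exact h3 _ hi

/-- **Jordan normal form of a square-zero endomorphism.** If `N² = 0` on a finite-dimensional
vector space with a basis indexed by `ι`, there is a basis `b` indexed by `ι`, a set `D ⊆ ι` and
`f : ι → ι` with `f(D) ∩ D = ∅`, `N bᵢ = b_{f i}` for `i ∈ D` and `N bᵢ = 0` for `i ∉ D`
(basis `v_j, N v_j, w_l` adapted to the flag `im N ≤ ker N ≤ V`). [folklore] -/
theorem exists_basis_of_sq_eq_zero {ι : Type*} [Fintype ι] (b₀ : Basis ι k V) (N : V →ₗ[k] V)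
    (hN : ∀ v, N (N v) = 0) :
    ∃ (b : Basis ι k V) (D : Finset ι) (f : ι → ι),
      (∀ i ∈ D, f i ∉ D) ∧ (∀ i ∈ D, N (b i) = b (f i)) ∧ ∀ i ∉ D, N (b i) = 0 := by
  classical
  -- the flag `im N ≤ ker N ≤ V`
  have hIK : LinearMap.range N ≤ LinearMap.ker N := by
    rintro _ ⟨v, rfl⟩
    exact hN v
  obtain ⟨V', hV'⟩ := (LinearMap.ker N).exists_isCompl
  -- `N` restricts to an isomorphism `V' ≃ im N`
  let e₀ : V' →ₗ[k] LinearMap.range N := N.rangeRestrict ∘ₗ V'.subtype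
  have he₀ : ∀ v : V', ((e₀ v : LinearMap.range N) : V) = N v := fun v => rfl
  have hinj : Function.Injective e₀ := by
    rw [← LinearMap.ker_eq_bot, LinearMap.ker_comp, LinearMap.ker_rangeRestrict,
      ← Submodule.disjoint_iff_comap_eq_bot]
    exact hV'.symm.disjoint
  have hsurj : Function.Surjective e₀ := by
    rintro ⟨_, v, rfl⟩
    have hv : v ∈ LinearMap.ker N ⊔ V' := by
      rw [hV'.sup_eq_top]
      exact Submodule.mem_top
    obtain ⟨y, hy, z, hz, hyz⟩ := Submodule.mem_sup.mp hv
    refine ⟨⟨z, hz⟩, Subtype.ext ?_⟩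
    rw [he₀]
    change N z = N v
    rw [← hyz, map_add, LinearMap.mem_ker.mp hy, zero_add]
  let e : V' ≃ₗ[k] LinearMap.range N := LinearEquiv.ofBijective e₀ ⟨hinj, hsurj⟩
  -- inside `ker N`: a complement `W` of `im N`
  let IK : Submodule k (LinearMap.ker N) := LinearMap.range (Submodule.inclusion hIK)
  obtain ⟨W, hW⟩ := IK.exists_isCompl
  let eI : LinearMap.range N ≃ₗ[k] IK :=
    LinearEquiv.ofInjective (Submodule.inclusion hIK) (Submodule.inclusion_injective hIK)
  -- bases
  let bV' := Module.finBasis k V'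
  let bW := Module.finBasis k W
  let bIK : Basis (Fin (finrank k V')) k IK := bV'.map (e.trans eI)
  let bK : Basis (Fin (finrank k V') ⊕ Fin (finrank k W)) k (LinearMap.ker N) :=
    (bIK.prod bW).map (Submodule.prodEquivOfIsCompl IK W hW)
  let bV : Basis (Fin (finrank k V') ⊕ (Fin (finrank k V') ⊕ Fin (finrank k W))) k V :=
    (bV'.prod bK).map (Submodule.prodEquivOfIsCompl V' (LinearMap.ker N) hV'.symm)
  have hb1 : ∀ j, bV (Sum.inl j) = (bV' j : V) := by
    intro j
    simp [bV, Basis.map_apply, Basis.prod_apply]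
  have hb2 : ∀ x, bV (Sum.inr x) = (bK x : V) := by
    intro x
    simp [bV, Basis.map_apply, Basis.prod_apply]
  have hb3 : ∀ j, (bK (Sum.inl j) : V) = N (bV' j : V) := by
    intro j
    simp [bK, bIK, e, eI, Basis.map_apply, Basis.prod_apply, LinearEquiv.ofBijective_apply]
    rfl
  refine exists_basis_reindex N bV (Finset.univ.map Function.Embedding.inl)
    (Sum.elim (fun j => Sum.inr (Sum.inl j)) Sum.inr) ?_ ?_ ?_ (bV.indexEquiv b₀)
  · intro i hi
    obtain ⟨j, -, rfl⟩ := Finset.mem_map.mp hi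
    simp
  · intro i hi
    obtain ⟨j, -, rfl⟩ := Finset.mem_map.mp hi
    change N (bV (Sum.inl j)) = bV (Sum.inr (Sum.inl j))
    rw [hb1, hb2, hb3]
  · rintro (j | x) hi
    · exact absurd (Finset.mem_map_of_mem _ (Finset.mem_univ j)) hi
    · rw [hb2]
      exact LinearMap.mem_ker.mp (bK x).2

end LinearAlgebra

section Matrices

variable {k : Type*} [Field k] {ι : Type*} [Fintype ι]

/-- Rows determine the linear forms: equal rows give equal `Matrix.toMvPolynomial`. [folklore] -/
theorem toMvPolynomial_eq_of_row_eq {M N : Matrix ι ι k} {i j : ι} (h : M i = N j) :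
    M.toMvPolynomial i = N.toMvPolynomial j := by
  simp only [Matrix.toMvPolynomial, h]

/-- A zero row gives the zero linear form. [folklore] -/
theorem toMvPolynomial_eq_zero_of_row_eq_zero {M : Matrix ι ι k} {i : ι} (h : M i = 0) :
    M.toMvPolynomial i = 0 := by
  simp only [Matrix.toMvPolynomial, h, Pi.zero_apply, map_zero, Finset.sum_const_zero]

/-- An algebra endomorphism of `k[xᵢ : i ∈ ι]` acting linearly on the coordinates with matrix `A`
(`φ xᵢ = Σⱼ A i j · xⱼ`) IS the linear substitution `bind₁ A.toMvPolynomial`. [folklore] -/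
theorem algHom_eq_bind₁_toMvPolynomial (φ : MvPolynomial ι k →ₐ[k] MvPolynomial ι k)
    (A : Matrix ι ι k) (hφ : ∀ i, φ (X i) = ∑ j, A i j • X j) :
    φ = bind₁ A.toMvPolynomial := by
  refine MvPolynomial.algHom_ext fun i => ?_
  rw [bind₁_X_right, hφ i]
  simp only [Matrix.toMvPolynomial, smul_eq_C_mul, C_mul_X_eq_monomial]

variable [DecidableEq ι]

/-- **Matrix form of the square-zero normal form**: if `M² = 0` there is an invertible `G` whose
rows `Gᵢ` satisfy `Gᵢ M = G_{f i}` for `i ∈ D` and `Gᵢ M = 0` for `i ∉ D`, with `f(D) ∩ D = ∅`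
(the rows of `G` are a Jordan basis of `v ↦ v M`). [folklore] -/
theorem exists_rows_of_mul_self_eq_zero (M : Matrix ι ι k) (hM : M * M = 0) :
    ∃ (G : Matrix ι ι k) (D : Finset ι) (f : ι → ι), IsUnit G ∧ (∀ i ∈ D, f i ∉ D) ∧
      (∀ i ∈ D, G i ᵥ* M = G (f i)) ∧ ∀ i ∉ D, G i ᵥ* M = 0 := by
  obtain ⟨b, D, f, h1, h2, h3⟩ := exists_basis_of_sq_eq_zero (Pi.basisFun k ι) M.vecMulLinear
    (fun v => by simp [Matrix.vecMul_vecMul, hM])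
  refine ⟨fun i j => b i j, D, f, ?_, h1, fun i hi => h2 i hi, fun i hi => h3 i hi⟩
  rw [← Matrix.linearIndependent_rows_iff_isUnit]
  exact b.linearIndependent

/-- **Conjugating a square-zero-plus-one matrix into coordinate-action form**: if
`(A − 1)² = 0` there is an invertible `G`, `D` and `f` with `f(D) ∩ D = ∅` such that the linear
substitution of `G A G⁻¹` sends `xᵢ ↦ xᵢ + x_{f i}` (`i ∈ D`) and `xᵢ ↦ xᵢ` (`i ∉ D`) — the
coordinate law of rung LSB. [folklore] -/
theorem exists_conj_toMvPolynomial (A : Matrix ι ι k) (hA : (A - 1) * (A - 1) = 0) :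
    ∃ (G : Matrix ι ι k) (D : Finset ι) (f : ι → ι), IsUnit G ∧ (∀ i ∈ D, f i ∉ D) ∧
      (∀ i ∈ D, (G * A * G⁻¹).toMvPolynomial i = X i + X (f i)) ∧
      ∀ i ∉ D, (G * A * G⁻¹).toMvPolynomial i = X i := by
  obtain ⟨G, D, f, hG, h1, h2, h3⟩ := exists_rows_of_mul_self_eq_zero (A - 1) hA
  have hGdet : IsUnit G.det := (Matrix.isUnit_iff_isUnit_det G).mp hG
  have key : G * A * G⁻¹ = 1 + G * (A - 1) * G⁻¹ := by
    rw [Matrix.mul_sub, Matrix.sub_mul, Matrix.mul_one, Matrix.mul_nonsing_inv G hGdet,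
      add_sub_cancel]
  have hrow : ∀ i, (G * (A - 1) * G⁻¹) i = (G i ᵥ* (A - 1)) ᵥ* G⁻¹ := fun i => rfl
  have hone : ∀ i, (1 : Matrix ι ι k).toMvPolynomial i = (X i : MvPolynomial ι k) := fun i => by
    rw [Matrix.toMvPolynomial_one]
  refine ⟨G, D, f, hG, h1, fun i hi => ?_, fun i hi => ?_⟩
  · have hPi : (G * (A - 1) * G⁻¹) i = (1 : Matrix ι ι k) (f i) := by
      rw [hrow, h2 i hi, ← Matrix.mul_nonsing_inv G hGdet]
      rfl
    rw [key, Matrix.toMvPolynomial_add, Pi.add_apply, hone, toMvPolynomial_eq_of_row_eq hPi, hone]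
  · have hPi : (G * (A - 1) * G⁻¹) i = 0 := by
      rw [hrow, h3 i hi, Matrix.zero_vecMul]
    rw [key, Matrix.toMvPolynomial_add, Pi.add_apply, hone,
      toMvPolynomial_eq_zero_of_row_eq_zero hPi, add_zero]

/-- `Matrix.toMvPolynomial` is injective: a matrix is determined by its linear forms (evaluate
at the standard basis vectors). [folklore] -/
theorem toMvPolynomial_injective {M N : Matrix ι ι k} (h : M.toMvPolynomial = N.toMvPolynomial) :
    M = N := by
  ext i j
  have hij := congrArg (MvPolynomial.eval (Pi.single j 1)) (congrFun h i)
  rw [Matrix.toMvPolynomial_eval_eq_apply, Matrix.toMvPolynomial_eval_eq_apply,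
    Matrix.mulVec_single_one, Matrix.mulVec_single_one] at hij
  exact hij

/-- Inverse matrices give inverse linear substitutions:
`bind₁ N.toMvPolynomial ∘ bind₁ M.toMvPolynomial = id` when `M N = 1`
(on `xᵢ` it is the linear form of row `i` of `M N`, Mathlib `Matrix.toMvPolynomial_mul`).
[folklore] -/
theorem bind₁_comp_bind₁_toMvPolynomial_of_mul_eq_one (M N : Matrix ι ι k) (h : M * N = 1) :
    (bind₁ N.toMvPolynomial).comp (bind₁ M.toMvPolynomial) =
      AlgHom.id k (MvPolynomial ι k) := by
  refine MvPolynomial.algHom_ext fun i => ?_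
  rw [AlgHom.comp_apply, bind₁_X_right, AlgHom.id_apply, ← Matrix.toMvPolynomial_mul, h,
    Matrix.toMvPolynomial_one]

end Matrices

/-- **Rung LSB-lin (square-zero normal form; every `p`, every `n`).** Let `σ` be a `k`-algebra
automorphism of `k[x₀,…,x_{n-1}]` (`k` of characteristic `p`) acting linearly on the coordinates,
`σ xᵢ = Σⱼ A i j · xⱼ`, with `(A − 1)² = 0` — i.e. every Jordan block of the linear part has
size `≤ 2` (for instance every LINEAR involution in characteristic `2`). Then the quotient
`Spec k[x]^⟨σ⟩ = 𝔸ⁿ/⟨σ⟩` admits a resolution of singularities: after the linear change of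
coordinates by a Jordan basis of `A − 1`, `σ` is a coordinate action with blocks `≤ 2` and rung
LSB (`LinearSmallBlocks.hasResolution`: one equivariant blow-up of the fixed coordinate subspace
is a Király–Lütkebohmert terminal model, then the cyclic transfer) applies; conjugate actions
have isomorphic quotients. [OURS · L1 W4.5c] [cite: KiralyLutkebohmert2013, Thm 2] -/
theorem hasResolution (p : ℕ) (hp : p.Prime) (k : Type) [Field k] [CharP k p] (n : ℕ)
    (σ : MvPolynomial (Fin n) k ≃ₐ[k] MvPolynomial (Fin n) k) (A : Matrix (Fin n) (Fin n) k)
    (hσ : ∀ i, σ (X i) = ∑ j, A i j • X j) (hA : (A - 1) * (A - 1) = 0) :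
    Scheme.HasResolution
      (Spec (.of (FixedPoints.subalgebra k (MvPolynomial (Fin n) k) (Subgroup.zpowers σ)))) := by
  classical
  obtain ⟨G, D, f, hG, hfD, hD, hnD⟩ := exists_conj_toMvPolynomial A hA
  have hGdet : IsUnit G.det := (Matrix.isUnit_iff_isUnit_det G).mp hG
  -- `σ` is the linear substitution of `A`
  have hσall : ∀ q, σ q = bind₁ A.toMvPolynomial q := fun q =>
    DFunLike.congr_fun
      (algHom_eq_bind₁_toMvPolynomial (σ : MvPolynomial (Fin n) k →ₐ[k] MvPolynomial (Fin n) k)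
        A hσ) q
  -- the change of coordinates `τ : xᵢ ↦ Σⱼ G i j xⱼ`
  let τ : MvPolynomial (Fin n) k ≃ₐ[k] MvPolynomial (Fin n) k :=
    AlgEquiv.ofAlgHom (bind₁ G.toMvPolynomial) (bind₁ G⁻¹.toMvPolynomial)
      (bind₁_comp_bind₁_toMvPolynomial_of_mul_eq_one G⁻¹ G (Matrix.nonsing_inv_mul G hGdet))
      (bind₁_comp_bind₁_toMvPolynomial_of_mul_eq_one G G⁻¹ (Matrix.mul_nonsing_inv G hGdet))
  have hτ : ∀ q, τ q = bind₁ G.toMvPolynomial q := fun q => rfl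
  have hτ' : ∀ q, τ⁻¹ q = bind₁ G⁻¹.toMvPolynomial q := fun q => rfl
  -- `τ⁻¹ σ τ` is the coordinate action of `G A G⁻¹`
  have hconj : ∀ i, (τ⁻¹ * σ * τ) (X i) = (G * A * G⁻¹).toMvPolynomial i := by
    intro i
    rw [AlgEquiv.mul_apply, AlgEquiv.mul_apply, hτ, bind₁_X_right, hσall,
      ← Matrix.toMvPolynomial_mul, hτ', ← Matrix.toMvPolynomial_mul]
  have h1 : ∀ i ∈ D, (τ⁻¹ * σ * τ) (X i) = X i + X (f i) := fun i hi => by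
    rw [hconj, hD i hi]
  have h2 : ∀ i ∉ D, (τ⁻¹ * σ * τ) (X i) = X i := fun i hi => by
    rw [hconj, hnD i hi]
  have hres := LinearSmallBlocks.hasResolution p hp k n (τ⁻¹ * σ * τ) D f hfD h1 h2
  have hres' := TameTransfer.hasResolution_fixedPoints_zpowers_conj (τ⁻¹ * σ * τ) τ hres
  have e : τ * (τ⁻¹ * σ * τ) * τ⁻¹ = σ := by group
  rwa [e] at hres'

/-- **Every LINEAR involution of `𝔸ⁿ` in characteristic `2` has a resolvable quotient** (every
`n`): for `σ` a `k`-algebra automorphism of `k[x₀,…,x_{n-1}]`, `char k = 2`, acting linearly on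
the coordinates (`σ xᵢ = Σⱼ A i j · xⱼ`) with `σ² = 1`, the quotient `𝔸ⁿ/⟨σ⟩ = Spec k[x]^⟨σ⟩`
admits a resolution of singularities. (`σ² = 1` forces `A² = 1`, i.e. `(A − 1)² = A² − 2A + 1 = 0`
in characteristic `2`; then `hasResolution`.) This is the complete LINEAR sector, at the prime
`2`, of the first open case `CyclicQuotientFourfolds` (stmt-…-17941: `|G| = p`, `dim ≤ 4`) — in all
dimensions. [OURS · L1 W4.5c] [cite: KiralyLutkebohmert2013, Thm 2] -/
theorem hasResolution_of_involutive (k : Type) [Field k] [CharP k 2] (n : ℕ)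
    (σ : MvPolynomial (Fin n) k ≃ₐ[k] MvPolynomial (Fin n) k) (A : Matrix (Fin n) (Fin n) k)
    (hσ : ∀ i, σ (X i) = ∑ j, A i j • X j) (h2 : σ * σ = 1) :
    Scheme.HasResolution
      (Spec (.of (FixedPoints.subalgebra k (MvPolynomial (Fin n) k) (Subgroup.zpowers σ)))) := by
  classical
  refine hasResolution 2 Nat.prime_two k n σ A hσ ?_
  have hσall : ∀ q, σ q = bind₁ A.toMvPolynomial q := fun q =>
    DFunLike.congr_fun
      (algHom_eq_bind₁_toMvPolynomial (σ : MvPolynomial (Fin n) k →ₐ[k] MvPolynomial (Fin n) k)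
        A hσ) q
  -- `σ² = 1` forces `A² = 1`
  have hAA : A * A = 1 := by
    refine toMvPolynomial_injective (funext fun i => ?_)
    rw [Matrix.toMvPolynomial_mul, ← hσall, ← bind₁_X_right A.toMvPolynomial i, ← hσall,
      ← AlgEquiv.mul_apply, h2, AlgEquiv.one_apply, Matrix.toMvPolynomial_one]
  -- hence `(A - 1)² = 2 (1 - A) = 0` in characteristic `2`
  rw [sub_mul, one_mul, mul_sub, mul_one, hAA]
  ext i j
  simp only [Matrix.sub_apply, Matrix.zero_apply]
  linear_combination ((1 : Matrix (Fin n) (Fin n) k) i j - A i j) * CharTwo.two_eq_zero (R := k)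

end Summit.ResolutionOfSingularities.ResolutionOfSingularities.Theorems.WildQuotientResolution.LinearSquareZero

end
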